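import Summits.MatrixMultiplication.OmegaCensus.SmallFormats.MatMul22nRankGF5ThreeNPlusThreeCore
import Summits.MatrixMultiplication.OmegaCensus.SmallFormats.MatMul22nRankGF5XCapWlog
import Summits.MatrixMultiplication.OmegaCensus.SmallFormats.MatMul22nRankGF5XCapCert
import HarnessLib

/-!
# ω-census family (a): `R_𝔽₅(⟨2,2,n⟩) ≥ 3n + 3` for `n ≥ 17` — kernel replay of the exact branch-and-bound certificate

Cell `pub-omega` (unit `pub-omega-tensor-g7`), topic `Summits/MatrixMultiplication/OmegaCensus` (sub-folder `SmallFormats`).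
Framing (verbatim): lottery ticket; floor = certified bounds/negative ranges. HONEST FRAMING: print (Alekseev 2014/2015, any
field) is `3n + 2`; the tree's counting theorem gives `3n + 3` over `𝔽₅` only from `n ≥ 19`; this file adds the cells `n = 17, 18`
over `𝔽₅` by a kernel-checked replay (`BoxCertificate`, `xcapCert5_ok`) of the certificate that the slack-2 X-cap system has no
solution of total `≥ 53`, after two sandwich normalisations (Lemma B below) that justify the WLOG rows. Nothing here is progress on `ω`.
-/

namespace Summit.MatrixMultiplication.OmegaCensus.SmallFormats

open Module Matrix Finset Literature.Computability.AlgebraicComplexity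
open Summit.MatrixMultiplication.OmegaCensus.RankOnePlaneCapGeneral

/-! ## Sandwiches act on classes -/

section SandClass
variable {k : Type*} [Field k]

/-- Composition of sandwiches. -/
theorem sand_sand (P Q P' Q' : Matrix (Fin 2) (Fin 2) k) (A : Fin 2 × Fin 2 → k) :
    sand P' Q' (sand P Q A) = sand (P * P') (Q' * Q) A := by
  funext p
  simp only [sand, Matrix.mul_apply, Fin.sum_univ_two]
  ring

/-- The trivial sandwich. -/
theorem sand_one_one (A : Fin 2 × Fin 2 → k) : sand 1 1 A = A := by
  funext ⟨a, b⟩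
  fin_cases a <;> fin_cases b <;> simp [sand, Matrix.one_apply]

/-- Sandwiches with invertible matrices are injective. -/
theorem sand_injective {P Q P' Q' : Matrix (Fin 2) (Fin 2) k} (hP : P * P' = 1) (hQ : Q' * Q = 1)
    {A B : Fin 2 × Fin 2 → k} (h : sand P Q A = sand P Q B) : A = B := by
  have := congrArg (sand P' Q') h
  rwa [sand_sand, sand_sand, hP, hQ, sand_one_one, sand_one_one] at this

/-- Sandwiches commute with scalars (function form). -/
theorem sand_smul_fun (P Q : Matrix (Fin 2) (Fin 2) k) (s : k) (B : Fin 2 × Fin 2 → k) :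
    sand P Q (fun p => s * B p) = fun p => s * sand P Q B p :=
  funext fun p => sand_smul (A := fun p => s * B p) (R := B) (fun _ => rfl) p

/-- Sandwich of the zero form. -/
theorem sand_zero_fun (P Q : Matrix (Fin 2) (Fin 2) k) : sand P Q (fun _ => (0 : k)) = fun _ => 0 := by
  funext p; simp [sand]

end SandClass

/-- Two forms have the same `xvar5` iff both are zero or they are nonzero proportional. -/
theorem xvar5_eq_iff (A B : Fin 2 × Fin 2 → ZMod 5) :
    xvar5 A = xvar5 B ↔ (A = (fun _ => 0) ∧ B = (fun _ => 0)) ∨ ∃ s : ZMod 5, s ≠ 0 ∧ A = fun p => s * B p := by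
  have z4 : (mk4 0 0 0 0 : Fin 2 × Fin 2 → ZMod 5) = fun _ => 0 := by
    funext ⟨a, b⟩; fin_cases a <;> fin_cases b <;> rfl
  constructor
  · intro h
    by_cases hA : A = fun _ => 0
    · have hA' : xvar5 A = 156 := (xvar5_eq_156 A).2 (by rw [hA, z4])
      have hB : B = mk4 0 0 0 0 := (xvar5_eq_156 B).1 (by rw [← h, hA'])
      exact Or.inl ⟨hA, by rw [hB, z4]⟩
    · have hA1 : A ≠ mk4 0 0 0 0 := by rwa [z4]
      have hB1 : B ≠ mk4 0 0 0 0 := by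
        intro hB
        have : xvar5 A = 156 := by rw [h]; exact (xvar5_eq_156 B).2 hB
        exact hA1 ((xvar5_eq_156 A).1 this)
      obtain ⟨sA, hsA, hArep⟩ := rep5_spec A hA1
      obtain ⟨sB, hsB, hBrep⟩ := rep5_spec B hB1
      refine Or.inr ⟨sA * sB⁻¹, mul_ne_zero hsA (inv_ne_zero hsB), funext fun p => ?_⟩
      rw [hArep p, h]
      have : rep5 (xvar5 B) p = sB⁻¹ * B p := by
        rw [hBrep p, ← mul_assoc, inv_mul_cancel₀ hsB, one_mul]
      rw [this]; ring
  · rintro (⟨hA, hB⟩ | ⟨s, hs, hAB⟩)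
    · rw [hA, hB]
    · rw [hAB, eq_mk4 B]
      have e : (fun p => s * mk4 (B (0, 0)) (B (0, 1)) (B (1, 0)) (B (1, 1)) p)
          = mk4 (s * B (0, 0)) (s * B (0, 1)) (s * B (1, 0)) (s * B (1, 1)) := by
        funext ⟨a, b⟩; fin_cases a <;> fin_cases b <;> rfl
      rw [e]; exact xvar5_smul s hs _ _ _ _

variable {ι : Type*} [Fintype ι] [DecidableEq ι]

omit [DecidableEq ι] in
/-- Class counts are transported by invertible sandwiches. -/
theorem xcount5_sand {P Q P' Q' : Matrix (Fin 2) (Fin 2) (ZMod 5)} (hP : P * P' = 1) (hQ : Q' * Q = 1)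
    (u : ι → Fin 2 × Fin 2 → ZMod 5) (t : ι) :
    xcount5 (fun i => sand P Q (u i)) (xvar5 (sand P Q (u t))) = xcount5 u (xvar5 (u t)) := by
  unfold xcount5
  congr 1
  ext t'
  simp only [mem_filter, mem_univ, true_and]
  rw [xvar5_eq_iff, xvar5_eq_iff]
  have hz : ∀ C : Fin 2 × Fin 2 → ZMod 5, sand P Q C = (fun _ => 0) ↔ C = fun _ => 0 := by
    intro C
    constructor
    · intro h; exact sand_injective hP hQ (by rw [h, sand_zero_fun])
    · intro h; rw [h, sand_zero_fun]
  have hs : ∀ (C E : Fin 2 × Fin 2 → ZMod 5) (s : ZMod 5), sand P Q C = (fun p => s * sand P Q E p) ↔ C = fun p => s * E p := by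
    intro C E s
    rw [← sand_smul_fun]
    constructor
    · intro h; exact sand_injective hP hQ h
    · intro h; rw [h]
  simp only [hz, hs]

omit [DecidableEq ι] in
/-- If `xcount5 u j > 0` then some form has index `j`. -/
theorem exists_of_xcount5_pos {u : ι → Fin 2 × Fin 2 → ZMod 5} {j : ℕ} (h : 0 < xcount5 u j) : ∃ t, xvar5 (u t) = j := by
  unfold xcount5 at h
  obtain ⟨t, ht⟩ := Finset.card_pos.1 h
  exact ⟨t, (mem_filter.1 ht).2⟩

omit [DecidableEq ι] in
/-- **Lemma B (normalisation).** Every computation of `⟨2,2,n⟩` over `𝔽₅` can be transported (two sandwiches) to one whose X-form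
class counts satisfy the WLOG rows of `xcapSys5`. -/
theorem exists_wlog_transport {n : ℕ} (β : BilinComp (mulBilin (ZMod 5) 2 2 n) ι) (u : ι → Fin 2 × Fin 2 → ZMod 5)
    (hA : ∀ i x, β.f i x = dotX (u i) x) :
    ∃ (β' : BilinComp (mulBilin (ZMod 5) 2 2 n) ι) (u' : ι → Fin 2 × Fin 2 → ZMod 5), (∀ i x, β'.f i x = dotX (u' i) x) ∧
      ∀ ρ, 350 ≤ ρ → ρ < 498 → xcount5 u' (symVar5 ρ) ≤ xcount5 u' (symPivot5 ρ) := by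
  classical
  -- reduce the WLOG rows to the two class statements
  suffices H : ∃ (β' : BilinComp (mulBilin (ZMod 5) 2 2 n) ι) (u' : ι → Fin 2 × Fin 2 → ZMod 5),
      (∀ i x, β'.f i x = dotX (u' i) x) ∧ (∀ j, isInv5 j = true → xcount5 u' j ≤ xcount5 u' 32) ∧
      (∀ j, isO1_5 j = true → xcount5 u' j ≤ xcount5 u' 33) by
    obtain ⟨β', u', hA', h1, h2⟩ := H
    refine ⟨β', u', hA', fun ρ h350 hρ => ?_⟩
    have hc := symVar5_class ⟨ρ, hρ⟩ h350
    by_cases h469 : ρ < 469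
    · obtain ⟨hi, -, hp⟩ := hc.1 h469
      rw [hp]; exact h1 _ hi
    · obtain ⟨ho, -, hp⟩ := hc.2 (not_lt.1 h469)
      rw [hp]; exact h2 _ ho
  -- Step 0: no invertible form at all
  by_cases hinv : ∃ t, det2 (u t) ≠ 0
  swap
  · refine ⟨β, u, hA, fun j hj => ?_, fun j hj => ?_⟩ <;>
    · suffices xcount5 u j = 0 by omega
      by_contra hne
      obtain ⟨t, ht⟩ := exists_of_xcount5_pos (u := u) (Nat.pos_of_ne_zero hne)
      have hdet : det2 (u t) ≠ 0 := (isInv5_xvar5 (u t)).2 (by rw [ht]; first | exact hj | exact isInv5_of_isO1_5 hj)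
      exact hinv ⟨t, hdet⟩
  -- Step 1: send a maximal invertible class to `I`
  obtain ⟨t₀, ht₀mem, ht₀max⟩ := exists_max_image (univ.filter fun t => det2 (u t) ≠ 0)
    (fun t => xcount5 u (xvar5 (u t))) (by obtain ⟨t, ht⟩ := hinv; exact ⟨t, by simp [ht]⟩)
  have hd₀ : det2 (u t₀) ≠ 0 := (mem_filter.1 ht₀mem).2
  have hPP : P1 (u t₀) * P1' (u t₀) = 1 := mul_eq_one_comm.1 (P1'_mul_P1 _ hd₀)
  set β₁ := xSandwich β (P1 (u t₀)) (P1' (u t₀)) 1 1 (P1'_mul_P1 _ hd₀) (Matrix.mul_one 1) with hβ₁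
  set u₁ : ι → Fin 2 × Fin 2 → ZMod 5 := fun i => sand (P1 (u t₀)) 1 (u i) with hu₁
  have hA₁ : ∀ i x, β₁.f i x = dotX (u₁ i) x := xSandwich_dotX β u hA _ _ _ _ _ _
  have h10 : u₁ t₀ = mk4 1 0 0 1 := funext (sand_P1 _ hd₀)
  have hdet₁ : ∀ t, det2 (u₁ t) ≠ 0 ↔ det2 (u t) ≠ 0 := by
    intro t
    show det2 (sand _ _ (u t)) ≠ 0 ↔ _
    rw [det2_sand, mdet2_one, mul_one]
    exact ⟨fun h => right_ne_zero_of_mul h, fun h => mul_ne_zero (mdet2_P1_ne_zero _ hd₀) h⟩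
  have hcnt₁ : ∀ t, xcount5 u₁ (xvar5 (u₁ t)) = xcount5 u (xvar5 (u t)) :=
    fun t => xcount5_sand hPP (Matrix.one_mul 1) u t
  have hI₁ : ∀ j, isInv5 j = true → xcount5 u₁ j ≤ xcount5 u₁ 32 := by
    intro j hj
    rcases Nat.eq_zero_or_pos (xcount5 u₁ j) with h0 | hpos
    · omega
    obtain ⟨t, ht⟩ := exists_of_xcount5_pos hpos
    have hdt : det2 (u t) ≠ 0 := (hdet₁ t).1 ((isInv5_xvar5 (u₁ t)).2 (by rw [ht]; exact hj))
    have hle := ht₀max t (by simp [hdt])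
    rw [← ht, hcnt₁ t, ← xvar5_idC5, ← h10, hcnt₁ t₀]
    exact hle
  -- Step 2: among ratio-{2,3} classes send a maximal one to `diag(1,2)` (if any)
  by_cases hO : ∃ t, isO1_5 (xvar5 (u₁ t)) = true
  swap
  · refine ⟨β₁, u₁, hA₁, hI₁, fun j hj => ?_⟩
    suffices xcount5 u₁ j = 0 by omega
    by_contra hne
    obtain ⟨t, ht⟩ := exists_of_xcount5_pos (u := u₁) (Nat.pos_of_ne_zero hne)
    exact hO ⟨t, by rw [ht]; exact hj⟩
  obtain ⟨t₁, ht₁mem, ht₁max⟩ := exists_max_image (univ.filter fun t => isO1_5 (xvar5 (u₁ t)) = true)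
    (fun t => xcount5 u₁ (xvar5 (u₁ t))) (by obtain ⟨t, ht⟩ := hO; exact ⟨t, by simp [ht]⟩)
  have ho₁ : isO1_5 (xvar5 (u₁ t₁)) = true := (mem_filter.1 ht₁mem).2
  have hj₁ : xvar5 (u₁ t₁) < 156 := by
    have := xvar5_lt (u₁ t₁)
    rcases Nat.lt_succ_iff_lt_or_eq.1 (show xvar5 (u₁ t₁) < 156 + 1 from this) with h | h
    · exact h
    · rw [h, isO1_5_156] at ho₁; exact absurd ho₁ Bool.false_ne_true
  obtain ⟨i, hi⟩ := (isO1_5_iff ⟨_, hj₁⟩).1 ho₁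
  obtain ⟨hQQ, hid, hs0, hdiag⟩ := cjD5_ok i
  have hPP2 : cjD5 i * cjDi5 i = 1 := mul_eq_one_comm.1 hQQ
  set β₂ := xSandwich β₁ (cjD5 i) (cjDi5 i) (cjDi5 i) (cjD5 i) hQQ hQQ with hβ₂
  set u₂ : ι → Fin 2 × Fin 2 → ZMod 5 := fun t => sand (cjD5 i) (cjDi5 i) (u₁ t) with hu₂
  have hA₂ : ∀ t x, β₂.f t x = dotX (u₂ t) x := xSandwich_dotX β₁ u₁ hA₁ _ _ _ _ _ _
  have hcnt₂ : ∀ t, xcount5 u₂ (xvar5 (u₂ t)) = xcount5 u₁ (xvar5 (u₁ t)) :=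
    fun t => xcount5_sand hPP2 hPP2 u₁ t
  have hdet₂ : ∀ t, det2 (u₂ t) ≠ 0 ↔ det2 (u₁ t) ≠ 0 := by
    intro t
    show det2 (sand _ _ (u₁ t)) ≠ 0 ↔ _
    rw [det2_sand]
    refine ⟨fun h => right_ne_zero_of_mul (left_ne_zero_of_mul h), fun h => ?_⟩
    exact mul_ne_zero (mul_ne_zero (mdet2_ne_zero_right hQQ) h) (mdet2_ne_zero_left hQQ)
  have h20 : u₂ t₀ = mk4 1 0 0 1 := by
    funext p
    show sand _ _ (u₁ t₀) p = _
    rw [h10]; exact hid p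
  have h21 : xvar5 (u₂ t₁) = 33 := by
    obtain ⟨s, hs, hrep⟩ := rep5_spec (u₁ t₁) (by
      intro h0
      have : xvar5 (u₁ t₁) = 156 := (xvar5_eq_156 _).2 h0
      rw [this, isO1_5_156] at ho₁; exact Bool.false_ne_true ho₁)
    have e1 : u₁ t₁ = fun p => s * rep5 (o1Idx5 i) p := by funext p; rw [hrep p, hi]
    have e2 : u₂ t₁ = fun p => (s * cjDs5 i) * mk4 1 0 0 2 p := by
      funext p
      show sand _ _ (u₁ t₁) p = _
      rw [e1, sand_smul_fun]
      show s * sand (cjD5 i) (cjDi5 i) (rep5 (o1Idx5 i)) p = _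
      rw [hdiag p, mul_assoc]
    rw [e2]; exact xvar5_D12 _ (mul_ne_zero hs hs0)
  refine ⟨β₂, u₂, hA₂, fun j hj => ?_, fun j hj => ?_⟩
  · rcases Nat.eq_zero_or_pos (xcount5 u₂ j) with h0 | hpos
    · omega
    obtain ⟨t, ht⟩ := exists_of_xcount5_pos hpos
    have hdt : det2 (u₁ t) ≠ 0 := (hdet₂ t).1 ((isInv5_xvar5 (u₂ t)).2 (by rw [ht]; exact hj))
    have hle := hI₁ (xvar5 (u₁ t)) ((isInv5_xvar5 (u₁ t)).1 hdt)
    rw [← ht, hcnt₂ t, ← xvar5_idC5, ← h20, hcnt₂ t₀, h10, xvar5_idC5]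
    exact hle
  · rcases Nat.eq_zero_or_pos (xcount5 u₂ j) with h0 | hpos
    · omega
    obtain ⟨t, ht⟩ := exists_of_xcount5_pos hpos
    have hot : isO1_5 (xvar5 (u₁ t)) = true := by
      have := cjD5_O1 i (u₁ t (0, 0)) (u₁ t (0, 1)) (u₁ t (1, 0)) (u₁ t (1, 1))
      rw [← eq_mk4 (u₁ t)] at this
      rw [← this]
      show isO1_5 (xvar5 (u₂ t)) = true
      rw [ht]; exact hj
    have hle := ht₁max t (by simp [hot])
    rw [← ht, hcnt₂ t, ← h21, hcnt₂ t₁]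
    exact hle

/-- **`R_𝔽₅(⟨2,2,n⟩) ≥ 3n + 3` for every `n ≥ 17`** (cells `n = 17, 18` new; `n ≥ 19` also by `27·R ≥ 84·n`). -/
theorem three_mul_add_three_le_tensorRank_matMulTensor_22n_gf5 (n : ℕ) (hn : 17 ≤ n) :
    3 * n + 3 ≤ tensorRank (matMulTensor (ZMod 5) 2 2 n) := by
  classical
  have h2 := three_mul_add_two_le_tensorRank_matMulTensor_22n_gf5 n (by omega)
  by_contra hlt
  obtain ⟨w, u, v, hdec⟩ := exists_triad_decomposition_tensorRank (matMulTensor (ZMod 5) 2 2 n)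
  have hA : ∀ i x, (bilinCompOfTriads (ZMod 5) w u v hdec).f i x = dotX (u i) x := fun i x => rfl
  obtain ⟨β', u', hA', hW⟩ := exists_wlog_transport (bilinCompOfTriads (ZMod 5) w u v hdec) u hA
  have hr : Fintype.card (Fin (tensorRank (matMulTensor (ZMod 5) 2 2 n))) ≤ 3 * n + 2 := by
    simp only [Fintype.card_fin]; omega
  have h52 := card_le_52_of_cert xcapCert5 xcapCert5_ok hr β' u' hA' hW
  simp only [Fintype.card_fin] at h52
  omega

/-- The kernel window over `𝔽₅` from `n = 17` on: `max(3n + 3, ⌈28n/9⌉) ≤ R_𝔽₅(⟨2,2,n⟩) ≤ ⌈7n/2⌉`. -/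
theorem tensorRank_matMulTensor_22n_gf5_window17 (n : ℕ) (hn : 17 ≤ n) :
    max (3 * n + 3) ((28 * n + 8) / 9) ≤ tensorRank (matMulTensor (ZMod 5) 2 2 n) ∧
      tensorRank (matMulTensor (ZMod 5) 2 2 n) ≤ (7 * n + 1) / 2 := by
  have h1 := three_mul_add_three_le_tensorRank_matMulTensor_22n_gf5 n hn
  have h2 := (tensorRank_matMulTensor_22n_gf5_window n (by omega)).1
  refine ⟨max_le h1 (le_trans (le_max_right _ _) h2), hopcroftKerr1971_tensorRank_matMulTensor_22n_le (K := ZMod 5) n⟩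

/-- The two census cells this file adds over `𝔽₅` (beyond the printed `3n + 2`): `54 ≤ R_𝔽₅(⟨2,2,17⟩) ≤ 60` and
`57 ≤ R_𝔽₅(⟨2,2,18⟩) ≤ 63`. -/
theorem tensorRank_matMulTensor_22n_gf5_numerals_17_18 :
    tensorRank (matMulTensor (ZMod 5) 2 2 17) ∈ Set.Icc 54 60 ∧ tensorRank (matMulTensor (ZMod 5) 2 2 18) ∈ Set.Icc 57 63 := by
  refine ⟨⟨?_, ?_⟩, ⟨?_, ?_⟩⟩
  · exact three_mul_add_three_le_tensorRank_matMulTensor_22n_gf5 17 (by norm_num)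
  · exact hopcroftKerr1971_tensorRank_matMulTensor_22n_le (K := ZMod 5) 17
  · exact three_mul_add_three_le_tensorRank_matMulTensor_22n_gf5 18 (by norm_num)
  · exact hopcroftKerr1971_tensorRank_matMulTensor_22n_le (K := ZMod 5) 18

/-- Orientations: `3n + 3 ≤ R` over `𝔽₅` for `⟨2,n,2⟩` and `⟨n,2,2⟩` as well (`n ≥ 17`). -/
theorem three_mul_add_three_le_tensorRank_matMulTensor_2n2_n22_gf5 (n : ℕ) (hn : 17 ≤ n) :
    3 * n + 3 ≤ tensorRank (matMulTensor (ZMod 5) 2 n 2) ∧ 3 * n + 3 ≤ tensorRank (matMulTensor (ZMod 5) n 2 2) := by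
  constructor
  · rw [(Blaser2013_lemma55 (ZMod 5) 2 n 2).1]; exact three_mul_add_three_le_tensorRank_matMulTensor_22n_gf5 n hn
  · rw [(Blaser2013_lemma55 (ZMod 5) n 2 2).2.1]; exact three_mul_add_three_le_tensorRank_matMulTensor_22n_gf5 n hn

end Summit.MatrixMultiplication.OmegaCensus.SmallFormats
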